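import Literature.Topology.FourManifolds.WallScaling
import HarnessLib

/-!
# Shrink scales uniform in the ratio: the shrunk wall frame knot for arbitrarily small `λ₀`

Topic `Literature/Topology/FourManifolds` (trunk T-4MAN). Fact seat
`provefact-Literature.Topology.FourManifolds.Knot.IsConnectedSum.isIsotopic` (Schubert's theorem),
geometric heart for rail knots. The shrink scale hypotheses `BandData.ShrinkScale` of
`ScalingFamily.lean` couple the scale `κ` of the spikes to the contraction ratio `λ₀` (field
`ray_depth`: `4κ‖frame‖ (2 + 5/(2λ₀)) < d`), so that at a fixed scale the southern content cannot
be contracted by an arbitrarily small ratio. The later insertion arguments need exactly that (the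
hosts, hence `κ`, are fixed before the unit is made small). The coupling is an artefact of one
crude estimate: the ray `oS + t (base - oS)` must avoid the far content for `0 < t ≤ 5/(6λ₀)`, and
`ScalingFamily.lean` bounds its depth through its blow-up norm for *all* such `t`. Here the ray is
treated in two regimes — for `t ≤ 2` by the blow-up norm (`≤ 8`), for `t ≥ 2` by the depth
covector (`ρ ≤ -ρ₁/2 - |ρ₃| ≤ 0`: the ray has left the open south) — which gives the
**uniform shrink scale hypotheses** `BandData.ShrinkScaleU hcross ε r A' κ` (a cone scale and a far
depth `d > 32 κ ‖frame‖`, no ratio), holding for all small `κ` (`exists_shrinkScaleU`), under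
which the whole construction of `ScalingFamily.lean` / `WallScaling.lean` goes through for **every**
ratio `λ₀ ∈ (0, 1]`:

* `Ypt_ne_rayLo'`, `Ypt_ne_rayHi'` (content points avoid the whole open rays), `injOn_scalePt'`;
* for a wall frame `F` (`BandData.IsWallFrame`): `injOn_wallScalePiece'`, `wallScalePiece_ne'`,
  `isRegularLoop_wallShrinkLoop'`, `injOn_wallScalePiece_Ico'`, the knots `b.frameKnot h hW`
  (`= wallKnot`) and `b.wallShrinkKnotU HU hW hl hB hAB` and the isotopy
  `isIsotopic_frameKnot_wallShrinkKnotU`.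

Everything is proved; no named facts are introduced.

## References

* M. W. Hirsch, *Differential Topology*, GTM 33, Springer (1976), Ch. 8 §1, Thm. 1.3.
  [HirschDT1976]
-/

open scoped Manifold ContDiff Topology Real
open Function Set Metric Filter

noncomputable section

namespace Literature.Topology.FourManifolds

/-- Local notation: `𝔼 n` is the model Euclidean space `EuclideanSpace ℝ (Fin n)`. -/
local notation "𝔼 " n:arg => EuclideanSpace ℝ (Fin n)

/-- Local notation: `𝕊 n` is the unit sphere in `EuclideanSpace ℝ (Fin (n + 1))`. -/
local notation "𝕊 " n:arg => (Metric.sphere (0 : EuclideanSpace ℝ (Fin (n + 1))) 1)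

attribute [local instance] fact_finrank_euclideanSpace_succ

open KnotsInBall

namespace BandData

variable {A B K : Knot} {avoid : Set (𝕊 3)} (b : BandData A B K avoid)

/-! ### The knot of a wall frame -/

/-- **The knot of a wall frame** (at a cone scale): the knot of the simple regular loop
`periodise alo F`. [folklore] -/
def frameKnot {hcross : b.band ⁻¹' sphereEquator 2 ∩ squareNhd b.δ = {x ∈ squareNhd b.δ | x 0 = 2⁻¹}}
    {ε r A' κ : ℝ} {h : b.ConeScale hcross ε r A' κ} {F : ℝ → 𝔼 4} (hW : b.IsWallFrame h F) : Knot :=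
  hW.isRegularLoop.toKnot (periodise_simple_iff.2 hW.injOn)

/-- The knot of a wall frame on the circle point of parameter `t`. [folklore] -/
theorem coe_frameKnot_circlePt {hcross : b.band ⁻¹' sphereEquator 2 ∩ squareNhd b.δ = {x ∈ squareNhd b.δ | x 0 = 2⁻¹}}
    {ε r A' κ : ℝ} {h : b.ConeScale hcross ε r A' κ} {F : ℝ → 𝔼 4} (hW : b.IsWallFrame h F) (t : ℝ) :
    ((b.frameKnot hW (circlePt t) : 𝕊 3) : 𝔼 4) = periodise b.alo F t :=
  hW.isRegularLoop.coe_toKnot_circlePt _ t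

/-- The knot of a wall frame is the `wallKnot` of `WallScaling.lean` (which carries a redundant
shrink scale). [folklore] -/
theorem wallKnot_eq_frameKnot {hcross : b.band ⁻¹' sphereEquator 2 ∩ squareNhd b.δ = {x ∈ squareNhd b.δ | x 0 = 2⁻¹}}
    {ε r A' κ lam₀ : ℝ} (H : b.ShrinkScale hcross ε r A' κ lam₀) {F : ℝ → 𝔼 4} (hW : b.IsWallFrame H.cone F) :
    b.wallKnot H hW = b.frameKnot hW := rfl

/-! ### The uniform shrink scale hypotheses -/

variable (hcross : b.band ⁻¹' sphereEquator 2 ∩ squareNhd b.δ = {x ∈ squareNhd b.δ | x 0 = 2⁻¹})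

/-- **The uniform shrink scale hypotheses**: a cone scale and a far depth `d` with
`32 κ ‖frame‖ < d` bounding below the depth of the far southern set (no contraction ratio).
[folklore] -/
structure ShrinkScaleU (ε r A' κ : ℝ) : Prop where
  cone : b.ConeScale hcross ε r A' κ
  ray_depth : ∃ d : ℝ, (∀ x ∈ b.farSouth (min (r / 2) (min b.gapLo b.gapHi)), d ≤ depth (psiN x)) ∧
    32 * κ * ‖((b.frame hcross : (𝔼 3) ≃L[ℝ] 𝔼 3) : (𝔼 3) →L[ℝ] 𝔼 3)‖ < d

variable {hcross} {ε r A' κ : ℝ} (HU : b.ShrinkScaleU hcross ε r A' κ)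
include HU

/-- A chart point of blow-up norm `≤ 8` is shallower than the far content. [folklore] -/
theorem depth_lt_of_norm_blowUp_le_eight {y : 𝔼 3} (hbu : ‖b.blowUp hcross κ y‖ ≤ 8) {x : 𝕊 3}
    (hx : x ∈ b.farSouth (min (r / 2) (min b.gapLo b.gapHi))) : depth y < depth (psiN x) := by
  obtain ⟨d, hd, hκd⟩ := HU.ray_depth
  have hκ := HU.cone.spike.κ_pos
  set N := ‖((b.frame hcross : (𝔼 3) ≃L[ℝ] 𝔼 3) : (𝔼 3) →L[ℝ] 𝔼 3)‖
  have hdist : ‖y - b.pZero‖ ≤ κ * N * 8 := by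
    refine (b.norm_sub_pZero_le hκ (hcross := hcross) y).trans ?_
    exact mul_le_mul_of_nonneg_left hbu (mul_nonneg hκ.le (norm_nonneg _))
  have hdy : depth y ≤ 4 * ‖y - b.pZero‖ := depth_le_four_mul_norm_sub (b.norm_pZero hcross)
  have := hd x hx
  nlinarith [norm_nonneg (y - b.pZero)]

/-- The far depth is positive. [folklore] -/
theorem depth_far_pos {x : 𝕊 3} (hx : x ∈ b.farSouth (min (r / 2) (min b.gapLo b.gapHi))) : 0 < depth (psiN x) := by
  obtain ⟨d, hd, hκd⟩ := HU.ray_depth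
  have hκ := HU.cone.spike.κ_pos
  have : 0 ≤ 32 * κ * ‖((b.frame hcross : (𝔼 3) ≃L[ℝ] 𝔼 3) : (𝔼 3) →L[ℝ] 𝔼 3)‖ := by positivity
  linarith [hd x hx]

/-- **A point of the lower ray `oS + t (baseLo - oS)`, `t ≥ 0`, is shallower than the far content**:
for `t ≤ 2` by the blow-up norm, for `t ≥ 2` because the depth covector is nonpositive there.
[folklore] -/
theorem depth_rayLo_lt' (hB : B.InSouth) {t : ℝ} (ht : 0 ≤ t) {x : 𝕊 3}
    (hx : x ∈ b.farSouth (min (r / 2) (min b.gapLo b.gapHi))) :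
    depth (b.oS hcross κ b.depthSign + t • (b.blowDown hcross κ (pt3 (1 / 4) (-1) 0) - b.oS hcross κ b.depthSign)) < depth (psiN x) := by
  have h := HU.cone
  have hκ := h.spike.κ_pos
  rcases le_or_gt t 2 with h2 | h2
  · refine b.depth_lt_of_norm_blowUp_le_eight HU ?_ hx
    rw [b.blowUp_rayLo h t]
    refine (norm_pt3_le _ _ _).trans ?_
    have h1 : |1 - 3 * t / 4| ≤ 1 + 3 * t / 4 := abs_le.2 ⟨by linarith, by linarith⟩
    have h2' : |(-t)| = t := by rw [abs_neg, abs_of_nonneg ht]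
    have h3 : |b.depthSign * (1 - t)| ≤ 1 + t := by
      rw [abs_mul, b.abs_depthSign, one_mul]; exact abs_le.2 ⟨by linarith, by linarith⟩
    linarith
  · -- `t ≥ 2`: the ray point is in the closed north
    set y := b.oS hcross κ b.depthSign + t • (b.blowDown hcross κ (pt3 (1 / 4) (-1) 0) - b.oS hcross κ b.depthSign)
    have hy : y = b.blowDown hcross κ (pt3 (1 - 3 * t / 4) (-t) (b.depthSign * (1 - t))) := by
      rw [← b.blowUp_rayLo h t, b.blowDown_blowUp hcross hκ.ne']
    have hρ : b.rho hcross (pt3 (1 - 3 * t / 4) (-t) (b.depthSign * (1 - t))) ≤ 0 := by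
      rw [b.rho_pt3]
      have h1 := b.rhoOne_nonneg hcross hB
      have h3 : b.rhoThree * (b.depthSign * (1 - t)) = |b.rhoThree| * (1 - t) := by
        rw [← b.depthSign_mul_rhoThree]; ring
      rw [h3]
      nlinarith [abs_nonneg b.rhoThree]
    have hd : depth y ≤ 0 := by
      rw [hy]
      refine (b.depth_blowDown_le hcross κ _).trans ?_
      nlinarith
    linarith [b.depth_far_pos HU hx]

/-- A point of the upper ray, `t ≥ 0`, is shallower than the far content. [folklore] -/
theorem depth_rayHi_lt' (hB : B.InSouth) {t : ℝ} (ht : 0 ≤ t) {x : 𝕊 3}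
    (hx : x ∈ b.farSouth (min (r / 2) (min b.gapLo b.gapHi))) :
    depth (b.oS hcross κ b.depthSign + t • (b.blowDown hcross κ (pt3 (1 / 4) 1 0) - b.oS hcross κ b.depthSign)) < depth (psiN x) := by
  have h := HU.cone
  have hκ := h.spike.κ_pos
  rcases le_or_gt t 2 with h2 | h2
  · refine b.depth_lt_of_norm_blowUp_le_eight HU ?_ hx
    rw [b.blowUp_rayHi h t]
    refine (norm_pt3_le _ _ _).trans ?_
    have h1 : |1 - 3 * t / 4| ≤ 1 + 3 * t / 4 := abs_le.2 ⟨by linarith, by linarith⟩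
    have h2' : |t| = t := abs_of_nonneg ht
    have h3 : |b.depthSign * (1 - t)| ≤ 1 + t := by
      rw [abs_mul, b.abs_depthSign, one_mul]; exact abs_le.2 ⟨by linarith, by linarith⟩
    linarith
  · set y := b.oS hcross κ b.depthSign + t • (b.blowDown hcross κ (pt3 (1 / 4) 1 0) - b.oS hcross κ b.depthSign)
    have hy : y = b.blowDown hcross κ (pt3 (1 - 3 * t / 4) t (b.depthSign * (1 - t))) := by
      rw [← b.blowUp_rayHi h t, b.blowDown_blowUp hcross hκ.ne']
    have hρ : b.rho hcross (pt3 (1 - 3 * t / 4) t (b.depthSign * (1 - t))) ≤ 0 := by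
      rw [b.rho_pt3]
      have h1 := b.rhoOne_nonneg hcross hB
      have h3 : b.rhoThree * (b.depthSign * (1 - t)) = |b.rhoThree| * (1 - t) := by
        rw [← b.depthSign_mul_rhoThree]; ring
      rw [h3]
      nlinarith [abs_nonneg b.rhoThree]
    have hd : depth y ≤ 0 := by
      rw [hy]
      refine (b.depth_blowDown_le hcross κ _).trans ?_
      nlinarith
    linarith [b.depth_far_pos HU hx]

variable (hB : B.InSouth) (hAB : Disjoint (range A) (range B))

include hB in
/-- **A point of the open lower ray is not the chart value of a general content parameter**: for
`s'` in the content set with `αLo s', αHi s' > 3/4`, `Y s' ≠ oS + t (baseLo - oS)` for every `t > 0`.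
[folklore] -/
theorem Ypt_ne_rayLo' {s' : ℝ} (hs' : s' ∈ b.contentSet HU.cone.spike.κ_pos HU.cone.spike.seven_le_gapLo HU.cone.spike.seven_le_gapHi)
    (hg1 : 3 / 4 < b.alphaLo κ s') (hg2 : 3 / 4 < b.alphaHi κ s') {t : ℝ} (ht : 0 < t) :
    b.Ypt HU.cone s' ≠ b.oS hcross κ b.depthSign + t • (b.blowDown hcross κ (pt3 (1 / 4) (-1) 0) - b.oS hcross κ b.depthSign) := by
  have h := HU.cone
  have hκ := h.spike.κ_pos
  have hf := h.spike.flat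
  intro he
  have hbu := congrArg (b.blowUp hcross κ) he
  rw [b.blowUp_rayLo h t] at hbu
  rcases b.content_cases h hs' with ⟨hsc, hα, hq, -, hY⟩ | ⟨hsc, hα, hq, -, hY⟩ | hfar
  · rw [hY] at hbu
    by_cases h3 : b.alphaLo κ s' ≤ 3
    · rw [b.blowUp_pieceLo_one_of_mem hcross hκ.ne' ⟨by linarith, h3⟩, modelLo] at hbu
      have e0 : b.alphaLo κ s' = 1 - 3 * t / 4 := by simpa using congrArg (fun Y : 𝔼 3 ↦ Y 0) hbu
      have e1 : -1 + spikeProfile (b.alphaLo κ s') = -t := by simpa using congrArg (fun Y : 𝔼 3 ↦ Y 1) hbu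
      have hlt := spikeProfile_lt_frac hg1
      have : spikeProfile (b.alphaLo κ s') = (b.alphaLo κ s' - 1 / 4) / (3 / 4) := by
        rw [eq_div_iff (by norm_num)]; linarith
      linarith
    · push Not at h3
      have h1 := b.one_lt_blowUp_pieceLo_one_zero h h3 hq
      have e0 : b.blowUp hcross κ (b.pieceLo hcross κ b.depthSign 1 (b.alphaLo κ s')) 0 = 1 - 3 * t / 4 := by
        simpa using congrArg (fun Y : 𝔼 3 ↦ Y 0) hbu
      linarith
  · rw [hY] at hbu
    by_cases h12 : b.alphaHi κ s' ≤ 12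
    · have hε5 : ε * (|b.alphaHi κ s'| + 1) ≤ 5 / 6 := by
        rw [abs_of_nonneg (by linarith)]; have := h.eps_le; have := hf.eps_nonneg; nlinarith
      have h6 := b.le_blowUp_pieceHi_one hf hκ ⟨zero_le_one, le_rfl⟩ b.depthSign hq hε5
      have e1 : b.blowUp hcross κ (b.pieceHi hcross κ b.depthSign 1 (b.alphaHi κ s')) 1 = -t := by
        simpa using congrArg (fun Y : 𝔼 3 ↦ Y 1) hbu
      linarith
    · push Not at h12
      have h1 := b.one_lt_blowUp_pieceHi_one_zero h (by linarith) hq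
      have e0 : b.blowUp hcross κ (b.pieceHi hcross κ b.depthSign 1 (b.alphaHi κ s')) 0 = 1 - 3 * t / 4 := by
        simpa using congrArg (fun Y : 𝔼 3 ↦ Y 0) hbu
      linarith
  · have hlt := b.depth_rayLo_lt' HU hB ht.le hfar
    rw [← he, Ypt] at hlt
    exact lt_irrefl _ hlt

include hB in
/-- A point of the open upper ray is not the chart value of a general content parameter. [folklore] -/
theorem Ypt_ne_rayHi' {s' : ℝ} (hs' : s' ∈ b.contentSet HU.cone.spike.κ_pos HU.cone.spike.seven_le_gapLo HU.cone.spike.seven_le_gapHi)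
    (hg1 : 3 / 4 < b.alphaLo κ s') (hg2 : 3 / 4 < b.alphaHi κ s') {t : ℝ} (ht : 0 < t) :
    b.Ypt HU.cone s' ≠ b.oS hcross κ b.depthSign + t • (b.blowDown hcross κ (pt3 (1 / 4) 1 0) - b.oS hcross κ b.depthSign) := by
  have h := HU.cone
  have hκ := h.spike.κ_pos
  have hf := h.spike.flat
  intro he
  have hbu := congrArg (b.blowUp hcross κ) he
  rw [b.blowUp_rayHi h t] at hbu
  rcases b.content_cases h hs' with ⟨hsc, hα, hq, -, hY⟩ | ⟨hsc, hα, hq, -, hY⟩ | hfar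
  · rw [hY] at hbu
    by_cases h12 : b.alphaLo κ s' ≤ 12
    · have hε5 : ε * (|b.alphaLo κ s'| + 1) ≤ 5 / 6 := by
        rw [abs_of_nonneg (by linarith)]; have := h.eps_le; have := hf.eps_nonneg; nlinarith
      have h6 := b.blowUp_pieceLo_one_le hf hκ ⟨zero_le_one, le_rfl⟩ b.depthSign hq hε5
      have e1 : b.blowUp hcross κ (b.pieceLo hcross κ b.depthSign 1 (b.alphaLo κ s')) 1 = t := by
        simpa using congrArg (fun Y : 𝔼 3 ↦ Y 1) hbu
      linarith
    · push Not at h12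
      have h1 := b.one_lt_blowUp_pieceLo_one_zero h (by linarith) hq
      have e0 : b.blowUp hcross κ (b.pieceLo hcross κ b.depthSign 1 (b.alphaLo κ s')) 0 = 1 - 3 * t / 4 := by
        simpa using congrArg (fun Y : 𝔼 3 ↦ Y 0) hbu
      linarith
  · rw [hY] at hbu
    by_cases h3 : b.alphaHi κ s' ≤ 3
    · rw [b.blowUp_pieceHi_one_of_mem hcross hκ.ne' ⟨by linarith, h3⟩, modelHi] at hbu
      have e0 : b.alphaHi κ s' = 1 - 3 * t / 4 := by simpa using congrArg (fun Y : 𝔼 3 ↦ Y 0) hbu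
      have e1 : 1 - spikeProfile (b.alphaHi κ s') = t := by simpa using congrArg (fun Y : 𝔼 3 ↦ Y 1) hbu
      have hlt := spikeProfile_lt_frac hg2
      have : spikeProfile (b.alphaHi κ s') = (b.alphaHi κ s' - 1 / 4) / (3 / 4) := by
        rw [eq_div_iff (by norm_num)]; linarith
      linarith
    · push Not at h3
      have h1 := b.one_lt_blowUp_pieceHi_one_zero h h3 hq
      have e0 : b.blowUp hcross κ (b.pieceHi hcross κ b.depthSign 1 (b.alphaHi κ s')) 0 = 1 - 3 * t / 4 := by
        simpa using congrArg (fun Y : 𝔼 3 ↦ Y 0) hbu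
      linarith
  · have hlt := b.depth_rayHi_lt' HU hB ht.le hfar
    rw [← he, Ypt] at hlt
    exact lt_irrefl _ hlt

include hB hAB in
/-- **The chart value is injective on the extended region.** [folklore] -/
theorem Ypt_injOn' : InjOn (b.Ypt HU.cone) {s | 1 / 4 ≤ b.alphaLo κ s ∧ 1 / 4 ≤ b.alphaHi κ s} := by
  have h := HU.cone
  intro s hs s' hs' he
  have h1 : b.knotPt h s = b.knotPt h s' := by
    rw [← b.psiN_symm_Ypt h (b.knotPt_ne_northPole h hB hs.1 hs.2), ← b.psiN_symm_Ypt h (b.knotPt_ne_northPole h hB hs'.1 hs'.2), he]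
  have h2 : b.spikePiece hcross κ b.depthSign 1 s = b.spikePiece hcross κ b.depthSign 1 s' := congrArg Subtype.val h1
  exact b.injOn_spikePiece_Ico h.spike hAB ⟨zero_le_one, le_rfl⟩ (b.mem_Ico_of_region h hs.1 hs.2) (b.mem_Ico_of_region h hs'.1 hs'.2) h2

include hB hAB in
/-- **The scaled chart point is injective on the content set** for every ratio `λ₀ ∈ (0, 1]` and
`u ∈ [0, 1]`. [folklore] -/
theorem injOn_scalePt' {lam₀ u : ℝ} (hl : lam₀ ∈ Ioc (0 : ℝ) 1) (hu : u ∈ Icc (0 : ℝ) 1) :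
    InjOn (b.scalePt HU.cone lam₀ u) (b.contentSet HU.cone.spike.κ_pos HU.cone.spike.seven_le_gapLo HU.cone.spike.seven_le_gapHi) := by
  have h := HU.cone
  have hκ := h.spike.κ_pos
  set c := u * (1 - lam₀)
  have hc : c ∈ Ico (0 : ℝ) 1 := cParam_mem hl hu
  set o := b.oS hcross κ b.depthSign
  have hψpos : ∀ {α : ℝ}, α ∈ Icc (3 / 8 : ℝ) (3 / 4) → 0 < spikeScalar c α := fun hα ↦ spikeScalar_pos hc (by linarith [hα.2])
  have ht_of : ∀ {α : ℝ}, α ∈ Icc (3 / 8 : ℝ) (3 / 4) → 0 < spikeScalar c α / (1 - c) := fun hα ↦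
    div_pos (hψpos hα) (by linarith [hc.2])
  have hgen : ∀ {s : ℝ}, 3 / 4 < b.alphaLo κ s → 3 / 4 < b.alphaHi κ s →
      b.scalePt h lam₀ u s = o + (1 - c) • (b.Ypt h s - o) := fun h1 h2 ↦ b.scalePt_general h (by linarith) (by linarith)
  have ray_of : ∀ {base : 𝔼 3} {ψ : ℝ} {s' : ℝ}, o + ψ • (base - o) = o + (1 - c) • (b.Ypt h s' - o) →
      b.Ypt h s' = o + (ψ / (1 - c)) • (base - o) := fun {base ψ s'} he ↦ by
    have h1c : (1 - c) ≠ 0 := by linarith [hc.2]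
    have := add_left_cancel he
    have h2 : b.Ypt h s' - o = (ψ / (1 - c)) • (base - o) := by
      rw [div_eq_inv_mul, mul_smul, this, smul_smul, inv_mul_cancel₀ h1c, one_smul]
    rw [← h2]; abel
  intro s hs s' hs' he
  rcases b.contentKind_cases h hs with ⟨hsc, hsα⟩ | ⟨hsc, hsα⟩ | ⟨hg1, hg2⟩ <;>
    rcases b.contentKind_cases h hs' with ⟨hsc', hsα'⟩ | ⟨hsc', hsα'⟩ | ⟨hg1', hg2'⟩
  · rw [b.scalePt_lowerSpike h (Ioo_subset_Icc_self hsc) ⟨by linarith [hsα.1], hsα.2⟩,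
      b.scalePt_lowerSpike h (Ioo_subset_Icc_self hsc') ⟨by linarith [hsα'.1], hsα'.2⟩] at he
    have h1 := smul_left_injective ℝ (b.baseLo_sub_oS_ne_zero h) (add_left_cancel he)
    have h2 : b.alphaLo κ s = b.alphaLo κ s' :=
      (strictAntiOn_spikeScalar hc).injOn (show b.alphaLo κ s ∈ Iio (1:ℝ) by simp; linarith [hsα.2])
        (show b.alphaLo κ s' ∈ Iio (1:ℝ) by simp; linarith [hsα'.2]) h1
    exact (b.strictMonoOn_alphaLo hκ).injOn (Ioo_subset_Icc_self hsc) (Ioo_subset_Icc_self hsc') h2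
  · rw [b.scalePt_lowerSpike h (Ioo_subset_Icc_self hsc) ⟨by linarith [hsα.1], hsα.2⟩,
      b.scalePt_upperSpike h (Ioo_subset_Icc_self hsc') ⟨by linarith [hsα'.1], hsα'.2⟩] at he
    have hbu := congrArg (fun y ↦ b.blowUp hcross κ y 1) he
    simp only [b.blowUp_rayLo h, b.blowUp_rayHi h, pt3_apply_one] at hbu
    linarith [hψpos hsα, hψpos hsα']
  · rw [b.scalePt_lowerSpike h (Ioo_subset_Icc_self hsc) ⟨by linarith [hsα.1], hsα.2⟩, hgen hg1' hg2'] at he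
    exact absurd (ray_of he) (b.Ypt_ne_rayLo' HU hB hs' hg1' hg2' (ht_of hsα))
  · rw [b.scalePt_upperSpike h (Ioo_subset_Icc_self hsc) ⟨by linarith [hsα.1], hsα.2⟩,
      b.scalePt_lowerSpike h (Ioo_subset_Icc_self hsc') ⟨by linarith [hsα'.1], hsα'.2⟩] at he
    have hbu := congrArg (fun y ↦ b.blowUp hcross κ y 1) he
    simp only [b.blowUp_rayLo h, b.blowUp_rayHi h, pt3_apply_one] at hbu
    linarith [hψpos hsα, hψpos hsα']
  · rw [b.scalePt_upperSpike h (Ioo_subset_Icc_self hsc) ⟨by linarith [hsα.1], hsα.2⟩,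
      b.scalePt_upperSpike h (Ioo_subset_Icc_self hsc') ⟨by linarith [hsα'.1], hsα'.2⟩] at he
    have h1 := smul_left_injective ℝ (b.baseHi_sub_oS_ne_zero h) (add_left_cancel he)
    have h2 : b.alphaHi κ s = b.alphaHi κ s' :=
      (strictAntiOn_spikeScalar hc).injOn (show b.alphaHi κ s ∈ Iio (1:ℝ) by simp; linarith [hsα.2])
        (show b.alphaHi κ s' ∈ Iio (1:ℝ) by simp; linarith [hsα'.2]) h1
    exact (b.strictAntiOn_alphaHi hκ).injOn (Ioo_subset_Icc_self hsc) (Ioo_subset_Icc_self hsc') h2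
  · rw [b.scalePt_upperSpike h (Ioo_subset_Icc_self hsc) ⟨by linarith [hsα.1], hsα.2⟩, hgen hg1' hg2'] at he
    exact absurd (ray_of he) (b.Ypt_ne_rayHi' HU hB hs' hg1' hg2' (ht_of hsα))
  · rw [hgen hg1 hg2, b.scalePt_lowerSpike h (Ioo_subset_Icc_self hsc') ⟨by linarith [hsα'.1], hsα'.2⟩] at he
    exact absurd (ray_of he.symm) (b.Ypt_ne_rayLo' HU hB hs hg1 hg2 (ht_of hsα'))
  · rw [hgen hg1 hg2, b.scalePt_upperSpike h (Ioo_subset_Icc_self hsc') ⟨by linarith [hsα'.1], hsα'.2⟩] at he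
    exact absurd (ray_of he.symm) (b.Ypt_ne_rayHi' HU hB hs hg1 hg2 (ht_of hsα'))
  · rw [hgen hg1 hg2, hgen hg1' hg2'] at he
    have h1c : (1 - c) ≠ 0 := by linarith [hc.2]
    have h1 := smul_right_injective (𝔼 3) h1c (add_left_cancel he)
    have h2 : b.Ypt h s = b.Ypt h s' := sub_left_injective h1
    exact b.Ypt_injOn' HU hB hAB ⟨by linarith, by linarith⟩ ⟨by linarith, by linarith⟩ h2

/-! ### The shrunk wall frame knot for every ratio -/

variable {F : ℝ → 𝔼 4} (hW : b.IsWallFrame HU.cone F) {lam₀ : ℝ} (hl : lam₀ ∈ Ioc (0 : ℝ) 1)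
include hW

include hB hAB hl in
/-- **The family of a wall frame is injective on the content set** (every ratio, `u ∈ [0, 1]`).
[folklore] -/
theorem injOn_wallScalePiece' {u : ℝ} (hu : u ∈ Icc (0 : ℝ) 1) :
    InjOn (b.wallScalePiece HU.cone F lam₀ u)
      (b.contentSet HU.cone.spike.κ_pos HU.cone.spike.seven_le_gapLo HU.cone.spike.seven_le_gapHi) := by
  intro s hs s' hs' he
  rw [b.wallScalePiece_eq_of_mem HU.cone hW lam₀ u hs, b.wallScalePiece_eq_of_mem HU.cone hW lam₀ u hs'] at he
  exact b.injOn_scalePt' HU hB hAB hl hu hs hs' (coe_psiN_symm_injective he)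

include hB hl in
/-- **The family of a wall frame avoids the walls.** [folklore] -/
theorem wallScalePiece_ne' {u : ℝ} (hu : u ∈ Icc (0 : ℝ) 1) {s : ℝ}
    (hs : s ∈ b.contentSet HU.cone.spike.κ_pos HU.cone.spike.seven_le_gapLo HU.cone.spike.seven_le_gapHi) {t : ℝ}
    (ht : t ∈ Ico b.alo (b.alo + 1))
    (hts : t ∉ b.contentSet HU.cone.spike.κ_pos HU.cone.spike.seven_le_gapLo HU.cone.spike.seven_le_gapHi) :
    b.wallScalePiece HU.cone F lam₀ u s ≠ F t := by
  rw [b.wallScalePiece_eq_of_mem HU.cone hW lam₀ u hs, scalePt]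
  exact b.cone_of_isWallPt HU.cone hB hs (b.scaleFn_mem_Icc01 ⟨hl.1.le, hl.2⟩ hu κ s) (hW.wall t ht hts)

include hB hl in
/-- **The shrunk wall frame loop is a regular loop** (every ratio, `u ∈ [0, 1]`). [folklore] -/
theorem isRegularLoop_wallShrinkLoop' {u : ℝ} (hu : u ∈ Icc (0 : ℝ) 1) :
    IsRegularLoop (periodise b.alo (b.wallScalePiece HU.cone F lam₀ u)) :=
  hW.isRegularLoop.periodise_of_eqOn_compl
    (b.contDiff_wallScalePiece_stage HU.cone hW hB lam₀ u) b.seamEps_bounds.1 hW.seam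
    (b.contentSet_subset_seam HU.cone) isClosed_Icc (fun _ ht ↦ b.wallScalePiece_eq_of_not_mem HU.cone hW hB lam₀ u ht)
    (fun _ hs ↦ b.norm_wallScalePiece_of_mem HU.cone hW lam₀ u hs)
    (fun _ hs ↦ b.deriv_wallScalePiece_ne_zero HU.cone hW hB hl hu hs)

include hB hAB hl in
/-- **The family of a wall frame is injective on the fundamental domain** (every ratio). [folklore] -/
theorem injOn_wallScalePiece_Ico' {u : ℝ} (hu : u ∈ Icc (0 : ℝ) 1) :
    InjOn (b.wallScalePiece HU.cone F lam₀ u) (Ico b.alo (b.alo + 1)) :=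
  injOn_Ico_of_eqOn_compl hW.injOn
    (fun _ ht ↦ b.wallScalePiece_eq_of_not_mem HU.cone hW hB lam₀ u ht) (b.injOn_wallScalePiece' HU hB hAB hW hl hu)
    (fun _ hs _ ht hts ↦ b.wallScalePiece_ne' HU hB hW hl hu hs ht hts)

/-- **The shrunk wall frame knot at ratio `λ₀`** (any `λ₀ ∈ (0, 1]`, uniform shrink scale).
[folklore] -/
def wallShrinkKnotU (hl : lam₀ ∈ Ioc (0 : ℝ) 1) (hB : B.InSouth) (hAB : Disjoint (range A) (range B)) : Knot :=
  (b.isRegularLoop_wallShrinkLoop' HU hB hW hl ⟨zero_le_one, le_rfl⟩).toKnot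
    (periodise_simple_iff.2 (b.injOn_wallScalePiece_Ico' HU hB hAB hW hl ⟨zero_le_one, le_rfl⟩))

/-- The shrunk wall frame knot on the circle point of parameter `t`. [folklore] -/
theorem coe_wallShrinkKnotU_circlePt (hl : lam₀ ∈ Ioc (0 : ℝ) 1) (hB : B.InSouth) (hAB : Disjoint (range A) (range B)) (t : ℝ) :
    ((b.wallShrinkKnotU HU hW hl hB hAB (circlePt t) : 𝕊 3) : 𝔼 4) = periodise b.alo (b.wallScalePiece HU.cone F lam₀ 1) t :=
  (b.isRegularLoop_wallShrinkLoop' HU hB hW hl ⟨zero_le_one, le_rfl⟩).coe_toKnot_circlePt _ t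

/-- **The knot of a wall frame is isotopic to its shrunk knot, for every ratio `λ₀ ∈ (0, 1]`.**
[cite: HirschDT1976, Ch. 8 §1, Thm. 1.3] -/
theorem isIsotopic_frameKnot_wallShrinkKnotU (hl : lam₀ ∈ Ioc (0 : ℝ) 1) (hB : B.InSouth) (hAB : Disjoint (range A) (range B)) :
    (b.frameKnot hW).IsIsotopic (b.wallShrinkKnotU HU hW hl hB hAB) :=
  IsRegularLoop.isIsotopic_of_modification (G := b.wallScalePiece HU.cone F lam₀)
    hW.isRegularLoop hW.injOn
    (b.isRegularLoop_wallShrinkLoop' HU hB hW hl ⟨zero_le_one, le_rfl⟩) (b.injOn_wallScalePiece_Ico' HU hB hAB hW hl ⟨zero_le_one, le_rfl⟩)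
    b.seamEps_bounds.1 hW.seam (b.contDiff_wallScalePiece HU.cone hW hB lam₀)
    (b.contentSet_subset_seam HU.cone) isClosed_Icc (fun u _ ht ↦ b.wallScalePiece_eq_of_not_mem HU.cone hW hB lam₀ u ht)
    (b.wallScalePiece_zero HU.cone hW hB lam₀)
    (fun u _ _ hs ↦ b.norm_wallScalePiece_of_mem HU.cone hW lam₀ u hs)
    (fun _ hu _ hs ↦ b.deriv_wallScalePiece_ne_zero HU.cone hW hB hl hu hs)
    (fun _ hu ↦ b.injOn_wallScalePiece' HU hB hAB hW hl hu)
    (fun _ hu _ hs _ ht hts ↦ b.wallScalePiece_ne' HU hB hW hl hu hs ht hts)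

omit HU hW

/-! ### The uniform shrink scale hypotheses hold for all small `κ` -/

/-- **Existence of uniform shrink scales**: in normal position (`B` south) there are `ε, r, A'`
such that every sufficiently small `κ > 0` is a uniform shrink scale. [folklore] -/
theorem exists_shrinkScaleU (hB : B.InSouth) :
    ∃ ε r A' κ₀ : ℝ, 0 < κ₀ ∧ ∀ κ', 0 < κ' → κ' ≤ κ₀ → b.ShrinkScaleU hcross ε r A' κ' := by
  obtain ⟨ε, r, A', κ₁, hκ₁, hcone⟩ := b.exists_coneScale hcross hB
  have hc1 := hcone κ₁ hκ₁ le_rfl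
  have hr : 0 < r := hc1.spike.flat.r_pos
  have hg : 0 < min (r / 2) (min b.gapLo b.gapHi) := lt_min (by linarith) (lt_min b.gapLo_pos b.gapHi_pos)
  obtain ⟨d, hd, hdepth⟩ := b.exists_depth_farSouth hcross hB hg
  set N := ‖((b.frame hcross : (𝔼 3) ≃L[ℝ] 𝔼 3) : (𝔼 3) →L[ℝ] 𝔼 3)‖
  have hN : 0 ≤ N := norm_nonneg _
  set κ₀ := min κ₁ (d / (64 * (N + 1))) with hκ₀
  have hκ₀pos : 0 < κ₀ := lt_min hκ₁ (by positivity)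
  refine ⟨ε, r, A', κ₀, hκ₀pos, fun κ' hκ' hle ↦ ⟨hcone κ' hκ' (hle.trans (min_le_left _ _)), d, hdepth, ?_⟩⟩
  have k : κ' ≤ d / (64 * (N + 1)) := hle.trans (min_le_right _ _)
  rw [le_div_iff₀ (by positivity)] at k
  nlinarith

end BandData

end Literature.Topology.FourManifolds
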